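import Literature.Analysis.FluidPDE.TaoAveragedAngleSynthesis
import Mathlib.Analysis.SpecialFunctions.Trigonometric.Inverse
import HarnessLib

/-!
# Rotations of `ℝ³` for Tao 2016, §3.6–§3.7: the rotation taking one unit vector to another
(explicit closing rotations), the rotation invariance of `Λ`, and smoothness of `R^θ_ξ`

T. Tao, *Finite time blowup for an averaged three-dimensional Navier–Stokes equation*,
J. Amer. Math. Soc. **29** (2016), 601–674 = arXiv:1402.0290v3 (held as `paper:arxiv-1402.0290`),
§3.6–§3.7, pp. 18–19: the rotation averaging behind (3.13) uses rotations `Rⱼ ∈ SO(3)` built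
from "the rotation `R^θ_ξ` by `θ` around the axis `ξ` using the right-hand rule" (footnote 6,
p. 19; the tree's `rodRot` / `rodRotEquiv`, `TaoAveragedNondegeneracy.lean` and
`TaoAveragedAngleSynthesis.lean`) and from closing rotations `R_{j,ξ₁,ξ₂,ξ₃} = I + O(ε₀³)` moving a
frequency direction `ξⱼ/|ξⱼ|` to a nearby `ξ̃ⱼ/|ξ̃ⱼ|` ((3.17); Tao obtains them from the implicit
function theorem), together with the invariance
`Λ_{R₁ξ₁,R₂ξ₂,R₃ξ₃}(R₁X₁,R₂X₂,R₃X₃) = Λ_{ξ̃}(…)` under a common rotation (display after (3.19)).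
This file supplies, over the tree's `ℝ³ ≃ₗᵢ[ℝ] ℝ³` (the type of the rotations of a
`ComplexAveragingDatum`):

* `rotTo x y` — **the rotation taking the unit vector `x` to the unit vector `y`** (`x · y ≠ -1`),
  in closed form `X ↦ (x·y) X + (x × y) × X + ((x × y)·X)/(1 + x·y) (x × y)` (Rodrigues' formula
  for the axis `x × y` and the angle `∠(x,y)`, degenerating smoothly to the identity at `y = x`),
  with `rotTo_self_apply` (`rotTo x y x = y`), `rotTo_self` (`rotTo x x = id`),
  `rotTo_eq_rodRot`, `norm_rotTo`, `rotToEquiv` and `det_rotToEquiv` (**`∈ SO(3)`**) — explicit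
  closing rotations for §3.7, with the smooth dependence made explicit (`contDiffAt_rotTo`);
* `Λ_rotMat` — **`Λ_{Sa,Sb}(SX, SY, SZ) = Λ_{a,b}(X, Y, Z)`** for `S` a linear isometry (acting on
  `ℂ³` by `S ⊗ 1 = rotMat S`), the invariance used after (3.19);
* complements on `R^θ_ξ`: periodicity `rodRot_add_two_pi`, continuity in `θ` and joint
  continuity `continuous_rodRot_uncurry`, smoothness `contDiffAt_rodRot` on `{ξ ≠ 0}`,
  `contDiffAt_udir`, `contDiff_cross`, `cross_antisymm`, `cross_cross_of_unit`.

## References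

* T. Tao, J. Amer. Math. Soc. 29 (2016), 601–674, arXiv:1402.0290v3, §3.6–3.7 pp. 18–19
  ((3.16)–(3.19), footnote 6). Key `Tao2016AveragedNS`.
-/

noncomputable section

open Real Matrix MeasureTheory
open scoped RealInnerProductSpace

namespace Literature.Analysis.FluidPDE.Tao2016

/-- Local notation for physical / frequency space `ℝ³`. -/
local notation "ℝ³" => EuclideanSpace ℝ (Fin 3)
/-- Local notation for the complexified range `ℂ³`. -/
local notation "ℂ³" => EuclideanSpace ℂ (Fin 3)

/-! ### Complements on `R^θ_ξ` (`rodRot`, `rodRotEquiv` of `TaoAveragedAngleSynthesis.lean`) -/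

/-- `R^θ_ξ` is `2π`-periodic in `θ`. [folklore] -/
theorem rodRot_add_two_pi (ξ : ℝ³) (θ : ℝ) (X : ℝ³) : rodRot ξ (θ + 2 * π) X = rodRot ξ θ X := by
  simp [rodRot, Real.cos_add_two_pi, Real.sin_add_two_pi]

/-- `R^θ_ξ` is continuous in `θ`. [folklore] -/
theorem continuous_rodRot_angle (ξ X : ℝ³) : Continuous fun θ : ℝ => rodRot ξ θ X := by
  unfold rodRot
  fun_prop

/-- `ξ = |ξ| u` with `u = ξ/|ξ|`. [folklore] -/
theorem eq_norm_smul_udir {ξ : ℝ³} (hξ : ξ ≠ 0) : ξ = ‖ξ‖ • udir ξ := by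
  rw [udir, smul_smul, mul_inv_cancel₀ (norm_ne_zero_iff.mpr hξ), one_smul]

/-- For a unit vector `u` and `P ⊥ u`: `u × (u × P) = -P`. [folklore] -/
theorem cross_cross_of_unit {u P : ℝ³} (hu : ‖u‖ = 1) (hP : ⟪P, u⟫ = 0) :
    cross u (cross u P) = -P := by
  rw [cross_cross_eq_smul_sub, real_inner_comm, hP, zero_smul, zero_sub, real_inner_self_eq_norm_sq, hu,
    one_pow, one_smul]

/-! ### The rotation taking a unit vector `x` to a unit vector `y` -/

/-- `y × x = −(x × y)` on `EuclideanSpace ℝ (Fin 3)`. [folklore] -/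
theorem cross_antisymm (x y : ℝ³) : cross y x = -cross x y := by
  ext i
  fin_cases i <;>
  simp only [cross, cross_apply, PiLp.neg_apply] <;> simp <;> ring

/-- **The rotation taking the unit vector `x` to the unit vector `y`** (`x · y ≠ -1`), in closed
form: `X ↦ (x·y) X + (x × y) × X + ((x × y)·X)/(1 + x·y) (x × y)` — Rodrigues' formula for the
rotation by the angle `∠(x, y)` about the axis `x × y` (`rotTo_eq_rodRot`), which degenerates
smoothly to the identity at `y = x`. These are explicit closing rotations `R_{j,ξ₁,ξ₂,ξ₃}` of
§3.7 ("one can find rotations `R_{j,ξ₁,ξ₂,ξ₃} ∈ SO(3)` … with `R_{j,ξ₁,ξ₂,ξ₃} = I + O(ε₀³)`" taking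
`ξⱼ/|ξⱼ|` to `ξ̃ⱼ/|ξ̃ⱼ|`; Tao invokes the implicit function theorem, the closed form makes the smooth
dependence explicit). Total; meaningful for unit `x, y` with `x · y ≠ -1`. [cite: Tao2016AveragedNS, §3.7 (3.17) p. 18] -/
def rotTo (x y X : ℝ³) : ℝ³ :=
  ⟪x, y⟫ • X + cross (cross x y) X + ((1 + ⟪x, y⟫)⁻¹ * ⟪cross x y, X⟫) • cross x y

/-- `rotTo x y` is additive. [folklore] -/
theorem rotTo_add (x y X Y : ℝ³) : rotTo x y (X + Y) = rotTo x y X + rotTo x y Y := by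
  unfold rotTo
  rw [cross_add_right, inner_add_right]
  module

/-- `rotTo x y` commutes with scalars. [folklore] -/
theorem rotTo_smul (x y : ℝ³) (r : ℝ) (X : ℝ³) : rotTo x y (r • X) = r • rotTo x y X := by
  unfold rotTo
  rw [cross_smul_right, real_inner_smul_right]
  module

/-- **`rotTo x y` takes `x` to `y`** (`|x| = 1`). [cite: Tao2016AveragedNS, §3.7 (3.17) p. 18] -/
theorem rotTo_self_apply {x : ℝ³} (hx : ‖x‖ = 1) (y : ℝ³) : rotTo x y x = y := by
  unfold rotTo
  rw [inner_cross_self_left, mul_zero, zero_smul, add_zero, cross_antisymm x (cross x y),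
    cross_cross_eq_smul_sub, real_inner_self_eq_norm_sq, hx, one_pow, one_smul]
  module

/-- `rotTo x x = id` for a unit vector `x` (the closing rotations equal `I` at the base
configuration). [folklore] -/
theorem rotTo_self {x : ℝ³} (hx : ‖x‖ = 1) (X : ℝ³) : rotTo x x X = X := by
  unfold rotTo
  rw [cross_self_eq_zero, real_inner_self_eq_norm_sq, hx, one_pow, one_smul]
  simp [cross]

/-- For unit `x, y`: `|x × y|² = 1 − (x·y)²`. [folklore] -/
theorem norm_cross_sq_of_unit {x y : ℝ³} (hx : ‖x‖ = 1) (hy : ‖y‖ = 1) :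
    ‖cross x y‖ ^ 2 = 1 - ⟪x, y⟫ ^ 2 := by
  rw [norm_cross_sq, hx, hy]
  ring

/-- For unit `x, y` with `x × y = 0` and `x · y ≠ -1`: `x · y = 1`. [folklore] -/
theorem inner_eq_one_of_cross_eq_zero {x y : ℝ³} (hx : ‖x‖ = 1) (hy : ‖y‖ = 1)
    (h0 : cross x y = 0) (hne : ⟪x, y⟫ ≠ -1) : ⟪x, y⟫ = 1 := by
  have h := norm_cross_sq_of_unit hx hy
  rw [h0, norm_zero] at h
  have h1 : ⟪x, y⟫ ^ 2 = 1 := by linarith [h]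
  rcases sq_eq_one_iff.1 h1 with h2 | h2
  · exact h2
  · exact absurd h2 hne

/-- If `x × y = 0` (unit `x, y`, `x · y ≠ -1`), `rotTo x y` is the identity. [folklore] -/
theorem rotTo_of_cross_eq_zero {x y : ℝ³} (hx : ‖x‖ = 1) (hy : ‖y‖ = 1) (h0 : cross x y = 0)
    (hne : ⟪x, y⟫ ≠ -1) (X : ℝ³) : rotTo x y X = X := by
  unfold rotTo
  rw [inner_eq_one_of_cross_eq_zero hx hy h0 hne, h0, one_smul]
  simp [cross]

/-- **`rotTo x y` is the rotation `R^φ_{x × y}` with `cos φ = x · y`**, `φ = arccos (x·y)`, when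
`x × y ≠ 0` (unit `x, y`). [cite: Tao2016AveragedNS, §3.7 footnote 6 p. 19] -/
theorem rotTo_eq_rodRot {x y : ℝ³} (hx : ‖x‖ = 1) (hy : ‖y‖ = 1) (h0 : cross x y ≠ 0) (X : ℝ³) :
    rotTo x y X = rodRot (cross x y) (Real.arccos ⟪x, y⟫) X := by
  -- abbreviations: `c = x·y`, `s = |x × y|`, `s² = 1 - c² = (1-c)(1+c)`
  have hs0 : ‖cross x y‖ ≠ 0 := norm_ne_zero_iff.mpr h0
  have hs2 : ‖cross x y‖ ^ 2 = 1 - ⟪x, y⟫ ^ 2 := norm_cross_sq_of_unit hx hy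
  have hcle : |⟪x, y⟫| ≤ 1 := by
    have h := abs_real_inner_le_norm x y
    rwa [hx, hy, mul_one] at h
  have hcos : Real.cos (Real.arccos ⟪x, y⟫) = ⟪x, y⟫ :=
    Real.cos_arccos (abs_le.1 hcle).1 (abs_le.1 hcle).2
  have hsin : Real.sin (Real.arccos ⟪x, y⟫) = ‖cross x y‖ := by
    rw [Real.sin_arccos, ← hs2, Real.sqrt_sq (norm_nonneg _)]
  have h1c : 1 + ⟪x, y⟫ ≠ 0 := by
    intro h
    have : ⟪x, y⟫ = -1 := by linarith
    rw [this] at hs2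
    apply hs0
    nlinarith [norm_nonneg (cross x y)]
  have h1c' : 1 - ⟪x, y⟫ ≠ 0 := by
    intro h
    have : ⟪x, y⟫ = 1 := by linarith
    rw [this] at hs2
    apply hs0
    nlinarith [norm_nonneg (cross x y)]
  -- the scalar identity `(1-c)/s² = 1/(1+c)`
  have key : ‖cross x y‖⁻¹ * ⟪cross x y, X⟫ * ‖cross x y‖⁻¹ * (1 - ⟪x, y⟫) =
      (1 + ⟪x, y⟫)⁻¹ * ⟪cross x y, X⟫ := by
    rw [show ‖cross x y‖⁻¹ * ⟪cross x y, X⟫ * ‖cross x y‖⁻¹ * (1 - ⟪x, y⟫) =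
        ⟪cross x y, X⟫ * (1 - ⟪x, y⟫) * (‖cross x y‖ ^ 2)⁻¹ by ring, hs2,
      show (1 : ℝ) - ⟪x, y⟫ ^ 2 = (1 - ⟪x, y⟫) * (1 + ⟪x, y⟫) by ring]
    field_simp
  -- expand `R^φ_{x×y}` and compare
  rw [rodRot, hcos, hsin, udir, real_inner_smul_right, cross_smul_left, smul_smul, smul_smul,
    mul_inv_cancel₀ hs0, one_smul, real_inner_comm, rotTo, ← key]
  module

/-- **`rotTo x y` is an isometry** for unit `x, y` with `x · y ≠ -1`. [folklore] -/
theorem norm_rotTo {x y : ℝ³} (hx : ‖x‖ = 1) (hy : ‖y‖ = 1) (hne : ⟪x, y⟫ ≠ -1) (X : ℝ³) :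
    ‖rotTo x y X‖ = ‖X‖ := by
  by_cases h0 : cross x y = 0
  · rw [rotTo_of_cross_eq_zero hx hy h0 hne]
  · rw [rotTo_eq_rodRot hx hy h0]
    exact norm_rodRot h0 _ X

/-- `rotTo x y` as a linear map. [folklore] -/
def rotToLin (x y : ℝ³) : ℝ³ →ₗ[ℝ] ℝ³ where
  toFun := rotTo x y
  map_add' := rotTo_add x y
  map_smul' r X := by rw [rotTo_smul, RingHom.id_apply]

/-- Unfolding `rotToLin`. [folklore] -/
@[simp]
theorem rotToLin_apply (x y X : ℝ³) : rotToLin x y X = rotTo x y X := rfl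

/-- The admissible pairs for `rotTo`: unit vectors that are not antipodal. [folklore] -/
def RotToAdmissible (x y : ℝ³) : Prop := ‖x‖ = 1 ∧ ‖y‖ = 1 ∧ ⟪x, y⟫ ≠ -1

/-- **`rotTo x y` as a linear isometry equivalence of `ℝ³`** (the identity for a non-admissible
pair, a junk case never used). [cite: Tao2016AveragedNS, §3.7 (3.17) p. 18] -/
def rotToEquiv (x y : ℝ³) : ℝ³ ≃ₗᵢ[ℝ] ℝ³ :=
  open Classical in
  if h : RotToAdmissible x y then
    (⟨rotToLin x y, fun X => norm_rotTo h.1 h.2.1 h.2.2 X⟩ : ℝ³ →ₗᵢ[ℝ] ℝ³).toLinearIsometryEquiv rfl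
  else LinearIsometryEquiv.refl ℝ ℝ³

/-- `rotToEquiv x y` acts as `rotTo x y` on admissible pairs. [folklore] -/
@[simp]
theorem rotToEquiv_apply {x y : ℝ³} (h : RotToAdmissible x y) (X : ℝ³) :
    rotToEquiv x y X = rotTo x y X := by
  simp [rotToEquiv, h]

/-- The linear map underlying `rotToEquiv x y` (admissible pair). [folklore] -/
theorem rotToEquiv_toLinearMap {x y : ℝ³} (h : RotToAdmissible x y) :
    ((rotToEquiv x y).toLinearEquiv : ℝ³ →ₗ[ℝ] ℝ³) = rotToLin x y := by
  apply LinearMap.ext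
  intro X
  exact rotToEquiv_apply h X

/-- **`rotTo x y ∈ SO(3)`**: `det = 1`. [cite: Tao2016AveragedNS, §3.7 p. 18] -/
theorem det_rotToEquiv (x y : ℝ³) :
    LinearMap.det ((rotToEquiv x y).toLinearEquiv : ℝ³ →ₗ[ℝ] ℝ³) = 1 := by
  by_cases h : RotToAdmissible x y
  · rw [rotToEquiv_toLinearMap h]
    by_cases h0 : cross x y = 0
    · have : rotToLin x y = LinearMap.id := by
        apply LinearMap.ext
        intro X
        rw [rotToLin_apply, rotTo_of_cross_eq_zero h.1 h.2.1 h0 h.2.2, LinearMap.id_apply]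
      rw [this, LinearMap.det_id]
    · have : rotToLin x y = rodRotLinear (cross x y) (Real.arccos ⟪x, y⟫) := by
        apply LinearMap.ext
        intro X
        rw [rotToLin_apply, rotTo_eq_rodRot h.1 h.2.1 h0]
        rfl
      rw [this, ← rodRotEquiv_toLinearMap h0, det_rodRotEquiv]
  · simp only [rotToEquiv, h, dite_false]
    exact LinearMap.det_id

/-- `rotToEquiv x y` takes `x` to `y`. [cite: Tao2016AveragedNS, §3.7 (3.17) p. 18] -/
theorem rotToEquiv_self_apply {x y : ℝ³} (h : RotToAdmissible x y) : rotToEquiv x y x = y := by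
  rw [rotToEquiv_apply h, rotTo_self_apply h.1]

/-! ### Invariance of `Λ` under a common rotation -/

/-- **`Λ_{Sa,Sb}(SX, SY, SZ) = Λ_{a,b}(X, Y, Z)`** for a linear isometry `S` of `ℝ³` acting on
`ℂ³` by its complexification `S ⊗ 1` (`rotMat S`): the invariance behind "then from (1.4) we see
that `Λ_{R₁ξ₁,R₂ξ₂,R₃ξ₃}(R₁X₁, R₂X₂, R₃X₃) = Λ_{ξ̃₁,ξ̃₂,ξ̃₃}(…)`", which removes the common rotation
`S` of the ansatz (3.19). [cite: Tao2016AveragedNS, §3.7 p. 19] -/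
theorem Λ_rotMat (S : ℝ³ ≃ₗᵢ[ℝ] ℝ³) (a b : ℝ³) (X Y Z : ℂ³) :
    Λ (S a) (S b) (rotMat S X) (rotMat S Y) (rotMat S Z) = Λ a b X Y Z := by
  unfold Λ
  rw [← rotMat_complexify S b, ← rotMat_complexify S a]
  simp only [cdot_complexifyCLM]

/-! ### Smoothness of the rotations in their parameters -/

/-- The cross product is smooth (bilinear). [folklore] -/
theorem contDiff_cross {n : WithTop ℕ∞} : ContDiff ℝ n fun p : ℝ³ × ℝ³ => cross p.1 p.2 :=
  crossCLM.isBoundedBilinearMap.contDiff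

/-- `ξ ↦ ξ/|ξ|` is smooth off the origin. [folklore] -/
theorem contDiffAt_udir {n : WithTop ℕ∞} {ξ : ℝ³} (hξ : ξ ≠ 0) : ContDiffAt ℝ n udir ξ := by
  unfold udir
  exact ((contDiffAt_norm ℝ hξ).inv (norm_ne_zero_iff.mpr hξ)).smul contDiffAt_id

/-- **`(ξ, θ, X) ↦ R^θ_ξ X` is smooth** on `{ξ ≠ 0}`. [folklore] -/
theorem contDiffAt_rodRot {n : WithTop ℕ∞} {p : ℝ³ × ℝ × ℝ³} (hp : p.1 ≠ 0) :
    ContDiffAt ℝ n (fun q : ℝ³ × ℝ × ℝ³ => rodRot q.1 q.2.1 q.2.2) p := by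
  unfold rodRot
  have hu : ContDiffAt ℝ n (fun q : ℝ³ × ℝ × ℝ³ => udir q.1) p :=
    (contDiffAt_udir hp).comp p contDiffAt_fst
  have hX : ContDiffAt ℝ n (fun q : ℝ³ × ℝ × ℝ³ => q.2.2) p := contDiffAt_snd.comp p contDiffAt_snd
  have hθ : ContDiffAt ℝ n (fun q : ℝ³ × ℝ × ℝ³ => q.2.1) p := contDiffAt_fst.comp p contDiffAt_snd
  have hin : ContDiffAt ℝ n (fun q : ℝ³ × ℝ × ℝ³ => ⟪q.2.2, udir q.1⟫) p := hX.inner ℝ hu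
  have hcr : ContDiffAt ℝ n (fun q : ℝ³ × ℝ × ℝ³ => cross (udir q.1) q.2.2) p :=
    contDiff_cross.contDiffAt.comp p (hu.prodMk hX)
  exact ((hin.smul hu).add ((Real.contDiff_cos.contDiffAt.comp p hθ).smul (hX.sub (hin.smul hu)))).add
    ((Real.contDiff_sin.contDiffAt.comp p hθ).smul hcr)

/-- **`(x, y, X) ↦ rotTo x y X` is smooth** on `{1 + x·y ≠ 0}`. [folklore] -/
theorem contDiffAt_rotTo {n : WithTop ℕ∞} {p : ℝ³ × ℝ³ × ℝ³} (hp : 1 + ⟪p.1, p.2.1⟫ ≠ 0) :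
    ContDiffAt ℝ n (fun q : ℝ³ × ℝ³ × ℝ³ => rotTo q.1 q.2.1 q.2.2) p := by
  unfold rotTo
  have hx : ContDiffAt ℝ n (fun q : ℝ³ × ℝ³ × ℝ³ => q.1) p := contDiffAt_fst
  have hy : ContDiffAt ℝ n (fun q : ℝ³ × ℝ³ × ℝ³ => q.2.1) p := contDiffAt_fst.comp p contDiffAt_snd
  have hX : ContDiffAt ℝ n (fun q : ℝ³ × ℝ³ × ℝ³ => q.2.2) p := contDiffAt_snd.comp p contDiffAt_snd
  have hc : ContDiffAt ℝ n (fun q : ℝ³ × ℝ³ × ℝ³ => ⟪q.1, q.2.1⟫) p := hx.inner ℝ hy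
  have hw : ContDiffAt ℝ n (fun q : ℝ³ × ℝ³ × ℝ³ => cross q.1 q.2.1) p :=
    contDiff_cross.contDiffAt.comp p (hx.prodMk hy)
  have hwX : ContDiffAt ℝ n (fun q : ℝ³ × ℝ³ × ℝ³ => cross (cross q.1 q.2.1) q.2.2) p :=
    contDiff_cross.contDiffAt.comp p (hw.prodMk hX)
  have hinv : ContDiffAt ℝ n (fun q : ℝ³ × ℝ³ × ℝ³ => (1 + ⟪q.1, q.2.1⟫)⁻¹) p :=
    (contDiffAt_const.add hc).inv hp
  exact ((hc.smul hX).add hwX).add ((hinv.mul (hw.inner ℝ hX)).smul hw)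

/-- `(θ, X) ↦ R^θ_ξ X` is jointly continuous (for the measurability of rotation families built
from `R^θ_ξ`). [folklore] -/
theorem continuous_rodRot_uncurry (ξ : ℝ³) : Continuous fun p : ℝ × ℝ³ => rodRot ξ p.1 p.2 := by
  unfold rodRot
  have hc : Continuous fun p : ℝ × ℝ³ => cross (udir ξ) p.2 :=
    continuous_cross.comp (continuous_const.prodMk continuous_snd)
  fun_prop

end Literature.Analysis.FluidPDE.Tao2016
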